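import Summits.PneNP.PneNP.Theorems.OneSliceConstantBandReadVars
import Summits.PneNP.PneNP.Theorems.OneSliceConstantBandExponentOneAux
import Summits.PneNP.PneNP.Theorems.OneSliceConstantBandAdvSparseGlue
import Summits.PneNP.PneNP.Theorems.OneSliceConstantBandRelMintermStep

/-!
# Route OneSlice, crux `ConstantBand` (stmt-PneNP-2834): the engine S4 at exponent `c ≤ 1`

Lead seat c7 (2026-08-17), line `flat-prior-relative-minterms`, `--supports stmt-PneNP-2834`. The one open stub of the line is
the engine `RelMintermSparse` (S4) `= ∀ c, ∃ k ≥ 3, ∃ ρ < 1/2, ∃ w₁, ∀ w ≥ w₁, ∀ᶠ n, …, |C| ≤ n^c → Σ_{lower band} pairProb_i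
(IsRelMinterm C.eval) ≤ ρ·#lower`, equivalently `AdvSparse` (p108157). This file proves BOTH at every exponent `c ≤ 1`, for
every `k ≥ 3`, with `ρ = 1/4` and `w₁ = 0` — the planted clique `K_A` is invisible to a circuit of size `≤ n` unless one of its
`C(k,2)` edges lies in the light cone (`≤ 2n+1` edges, `fprm_lightCone_junta`), which happens for a fraction
`≤ (2n+1)·k(k-1)/(n(n-1)) → 0` of the `k`-sets `A`:

* `fprm_pairProb_touch_le` — `P_A[K_A touches V] ≤ #V·k(k-1)/(n(n-1))`;
* `fprm_adv_le_touch` — for a `V`-junta `f`, `P_{(x,A)}[f(x ∪ K_A) = 1] − P_x[f(x) = 1] ≤ P_A[K_A touches V]`;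
* `fprm_advSparse_small` — for `k ≥ 3`, eventually in `n`, every `{∧₂,∨₂}`-circuit of size `≤ n` has planted-detection
  advantage `≤ 1/4` on EVERY slice, hence `≤ #lower/4` summed over any lower band;
* `fprm_advSparse_le_one`, `fprm_relMintermSparse_le_one` — the engine in both forms at every exponent `c ≤ 1`.

So the residual difficulty of S4 starts, like the crux's (`fprm_constantBandSchedule_le_one`), at exponent `c = 2`. [folklore]
-/

set_option linter.dupNamespace false

noncomputable section

namespace Summit.PneNP.PneNP.Cruxes.ConstantBand.FlatPriorRelativeMinterms

open Literature.Computability.Complexity Finset Filter Classical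

variable {n : ℕ}

/-! ## The planted clique rarely touches a small set of edges -/

/-- The `k`-sets whose clique touches `V` number at most `#V · C(n-2, k-2)` (`k ≥ 2`). [folklore] -/
theorem card_filter_touch_le (V : Finset (Edge n)) {k : ℕ} (hk : 2 ≤ k) :
    #((powersetCard k (univ : Finset (Fin n))).filter fun A => ∃ e ∈ V, cliqueVec A e = true) ≤
      #V * (n - 2).choose (k - 2) := by
  have hTsub : ((powersetCard k (univ : Finset (Fin n))).filter fun A => ∃ e ∈ V, cliqueVec A e = true) ⊆
      V.biUnion fun e => (powersetCard k univ).filter fun A => cliqueVec A e = true := by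
    intro A hA
    rw [mem_filter] at hA
    obtain ⟨hAk, e, heV, he⟩ := hA
    exact mem_biUnion.2 ⟨e, heV, mem_filter.2 ⟨hAk, he⟩⟩
  refine (card_le_card hTsub).trans (card_biUnion_le.trans ?_)
  have heach : ∀ e ∈ V, #((powersetCard k univ).filter fun A : Finset (Fin n) => cliqueVec A e = true) =
      (n - 2).choose (k - 2) := by
    intro e _
    have h := card_filter_powersetCard_subset (endpts e) (univ : Finset (Fin n)) k (subset_univ _)
      (by rw [card_endpts]; exact hk)
    rw [card_univ, Fintype.card_fin, card_endpts] at h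
    rw [← h]
    congr 1
    exact filter_congr fun A _ => cliqueVec_eq_true_iff_endpts A e
  rw [sum_congr rfl heach, sum_const, smul_eq_mul]

/-- **`P_A[K_A touches V] ≤ #V · k(k-1) / (n(n-1))`** in the planted-pair measure of any slice (`2 ≤ k ≤ n`). [folklore] -/
theorem fprm_pairProb_touch_le (V : Finset (Edge n)) {k : ℕ} (i : ℕ) (hk : 2 ≤ k) (hkn : k ≤ n) :
    pairProb n k i (fun _ A => ∃ e ∈ V, cliqueVec A e = true) ≤ #V * ((k * (k - 1) : ℕ) : ℝ) / ((n * (n - 1) : ℕ) : ℝ) := by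
  have hn : 2 ≤ n := hk.trans hkn
  have hC : 0 < n.choose k := Nat.choose_pos hkn
  have hnn : 0 < n * (n - 1) := Nat.mul_pos (by omega) (by omega)
  set T : Finset (Finset (Fin n)) := (powersetCard k (univ : Finset (Fin n))).filter
    fun A => ∃ e ∈ V, cliqueVec A e = true with hT
  have h1 : #T ≤ #V * (n - 2).choose (k - 2) := card_filter_touch_le V hk
  have h2 := choose_mul_eq_mul_choose_sub_two hn hk
  -- `#T · n(n-1) ≤ #V · C(n-2,k-2) · n(n-1) = #V · k(k-1) · C(n,k)`
  have h3 : #T * (n * (n - 1)) ≤ #V * (k * (k - 1)) * n.choose k := by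
    calc #T * (n * (n - 1)) ≤ #V * (n - 2).choose (k - 2) * (n * (n - 1)) := Nat.mul_le_mul_right _ h1
      _ = #V * (n.choose k * (k * (k - 1))) := by rw [h2]; ring
      _ = #V * (k * (k - 1)) * n.choose k := by ring
  unfold pairProb
  dsimp only
  rcases Nat.eq_zero_or_pos #(slice n i) with hs | hs
  · have hsl : slice n i = ∅ := card_eq_zero.1 hs
    simp [hsl]
    positivity
  have hs' : (0 : ℝ) < #(slice n i) := by exact_mod_cast hs
  -- the event depends on `A` only: the count is at most `#slice · #T`
  refine le_trans (div_le_div_of_nonneg_right (?_ : _ ≤ ((#(slice n i) * #T : ℕ) : ℝ)) (by positivity)) ?_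
  · rw [← card_product]
    exact_mod_cast card_le_card fun xa hxa => by
      simp only [mem_filter, mem_product] at hxa
      exact mem_product.2 ⟨hxa.1.1, mem_filter.2 ⟨hxa.1.2, hxa.2⟩⟩
  · rw [Nat.cast_mul, mul_div_mul_left _ _ hs'.ne',
      div_le_div_iff₀ (by exact_mod_cast hC) (by exact_mod_cast hnn)]
    exact_mod_cast h3

/-! ## Advantage of a junta -/

/-- **A `V`-junta cannot see a planted clique that misses `V`**: for `f` depending only on the edges in `V` and `k ≤ n`,
`P_{(x,A)}[f(x ∪ K_A) = 1] − P_x[f(x) = 1] ≤ P_A[K_A touches V]` on every slice. [folklore] -/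
theorem fprm_adv_le_touch (V : Finset (Edge n)) {k : ℕ} (i : ℕ) (hkn : k ≤ n) (f : (Edge n → Bool) → Bool)
    (hfV : ∀ x y : Edge n → Bool, (∀ e ∈ V, x e = y e) → f x = f y) :
    pairProb n k i (fun x A => f (plantClique A x) = true) - sliceProb n i (fun x => f x = true) ≤
      pairProb n k i (fun _ A => ∃ e ∈ V, cliqueVec A e = true) := by
  have hcover : ∀ (x : Edge n → Bool) (A : Finset (Fin n)), f (plantClique A x) = true →
      f x = true ∨ (∃ e ∈ V, cliqueVec A e = true) ∨ False := by
    intro x A hfx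
    by_cases ht : ∃ e ∈ V, cliqueVec A e = true
    · exact Or.inr (Or.inl ht)
    · left
      push Not at ht
      rw [← hfx]
      refine hfV x (plantClique A x) fun e he => ?_
      have : cliqueVec A e = false := by simpa using ht e he
      simp [plantClique, this]
  have h := rms_pairProb_le_add3 (n := n) (k := k) (i := i) hcover
  have h0 : pairProb n k i (fun _ _ => False) = 0 := by simp [pairProb]
  rw [h0, add_zero, rms_pairProb_fst hkn] at h
  linarith

/-! ## The engine at exponent `c ≤ 1` -/

/-- **Small circuits have small planted-detection advantage on every slice.** For `k ≥ 3`, eventually in `n`: every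
`{∧₂,∨₂}`-circuit of size `≤ n` has `P_{(x,A)}[C(x ∪ K_A) = 1] − P_x[C(x) = 1] ≤ 1/4` on EVERY slice `i`
(light cone `≤ 2n+1` edges; `(2n+1)·k(k-1) ≤ n(n-1)/4` for large `n`). [folklore] -/
theorem fprm_advSparse_small (k : ℕ) (hk : 3 ≤ k) :
    ∀ᶠ n : ℕ in atTop, ∀ i : ℕ, ∀ C : Circuit (Edge n), C.IsOver monotoneBasis → C.size ≤ n →
      pairProb n k i (fun x A => C.eval (plantClique A x) = true) - sliceProb n i (fun x => C.eval x = true) ≤ 1 / 4 := by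
  have hk2 : 2 ≤ k := by omega
  filter_upwards [eventually_ge_atTop (max k (12 * (k * (k - 1)) + 1))] with n hn i C hC hsize
  have hkn : k ≤ n := le_trans (le_max_left _ _) hn
  have hn1 : 12 * (k * (k - 1)) + 1 ≤ n := le_trans (le_max_right _ _) hn
  set V : Finset (Edge n) := C.lightCone with hVdef
  have hV : #V ≤ 2 * C.size + 1 := fprm_card_lightCone_le_of_monotoneBasis C hC
  have hfV : ∀ x y : Edge n → Bool, (∀ e ∈ V, x e = y e) → C.eval x = C.eval y :=
    fun x y hxy => C.eval_congr_lightCone hxy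
  refine (fprm_adv_le_touch V i hkn C.eval hfV).trans ((fprm_pairProb_touch_le V i hk2 hkn).trans ?_)
  have hnn : 0 < n * (n - 1) := Nat.mul_pos (by omega) (by omega)
  rw [div_le_div_iff₀ (by exact_mod_cast hnn) (by norm_num)]
  -- `4 · #V · k(k-1) ≤ 4(2n+1)k(k-1) ≤ 12n·k(k-1) ≤ n(n-1)`
  have h : #V * (k * (k - 1)) * 4 ≤ 1 * (n * (n - 1)) := by
    calc #V * (k * (k - 1)) * 4 ≤ (2 * n + 1) * (k * (k - 1)) * 4 := by
          apply Nat.mul_le_mul_right; apply Nat.mul_le_mul_right; omega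
      _ ≤ (3 * n) * (k * (k - 1)) * 4 := by
          apply Nat.mul_le_mul_right; apply Nat.mul_le_mul_right; omega
      _ = n * (12 * (k * (k - 1))) := by ring
      _ ≤ n * (n - 1) := Nat.mul_le_mul_left _ (by omega)
      _ = 1 * (n * (n - 1)) := (one_mul _).symm
  exact_mod_cast h

/-- **`AdvSparse` at every exponent `c ≤ 1`** (registered sub-goal `fprm_advSparse_le_one` of stmt-PneNP-2834): for `c ≤ 1`
there are `k ≥ 3` (any), `ρ = 1/4 < 1/2` and `w₁ = 0` such that for every `w`, eventually in `n`, for central `j` and every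
`{∧₂,∨₂}`-circuit of size `≤ n^c`, the planted-detection advantage summed over the lower band is `≤ ρ · #lower`. [folklore] -/
theorem fprm_advSparse_le_one :
    ∀ c : ℕ, c ≤ 1 → ∃ k : ℕ, 3 ≤ k ∧ ∃ ρ : ℝ, ρ < 1 / 2 ∧ ∃ w₁ : ℕ, ∀ w : ℕ, w₁ ≤ w → ∀ᶠ n : ℕ in atTop,
      ∀ j : ℕ, Central k n j → ∀ C : Circuit (Edge n), C.IsOver monotoneBasis → C.size ≤ n ^ c →
        ∑ i ∈ lowerBand k j w, (pairProb n k i (fun x A => C.eval (plantClique A x) = true)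
            - sliceProb n i (fun x => C.eval x = true)) ≤ ρ * #(lowerBand k j w) := by
  intro c hc
  refine ⟨3, le_rfl, 1 / 4, by norm_num, 0, fun w _ => ?_⟩
  filter_upwards [fprm_advSparse_small 3 le_rfl, eventually_ge_atTop 1] with n hn hn1 j _ C hC hsize
  have hsize' : C.size ≤ n := hsize.trans (by simpa using Nat.pow_le_pow_right hn1 hc)
  calc ∑ i ∈ lowerBand 3 j w, (pairProb n 3 i (fun x A => C.eval (plantClique A x) = true)
          - sliceProb n i (fun x => C.eval x = true))
      ≤ ∑ _i ∈ lowerBand 3 j w, (1 / 4 : ℝ) := sum_le_sum fun i _ => hn i C hC hsize'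
    _ = 1 / 4 * #(lowerBand 3 j w) := by rw [sum_const, nsmul_eq_mul, mul_comm]

/-- **`RelMintermSparse` (S4) at every exponent `c ≤ 1`** (registered sub-goal `fprm_relMintermSparse_le_one` of
stmt-PneNP-2834): the one open stub of the line holds at `c ≤ 1` — relative clique-minterms of size-`n` monotone circuits have
density `≤ 1/4` under the lower-band law (density ≤ advantage, `fprm_pairProb_relMinterm_le_adv`). [folklore] -/
theorem fprm_relMintermSparse_le_one :
    ∀ c : ℕ, c ≤ 1 → ∃ k : ℕ, 3 ≤ k ∧ ∃ ρ : ℝ, ρ < 1 / 2 ∧ ∃ w₁ : ℕ, ∀ w : ℕ, w₁ ≤ w → ∀ᶠ n : ℕ in atTop,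
      ∀ j : ℕ, Central k n j → ∀ C : Circuit (Edge n), C.IsOver monotoneBasis → C.size ≤ n ^ c →
        ∑ i ∈ lowerBand k j w, pairProb n k i (IsRelMinterm C.eval) ≤ ρ * #(lowerBand k j w) := by
  intro c hc
  obtain ⟨k, hk, ρ, hρ, w₁, hA⟩ := fprm_advSparse_le_one c hc
  refine ⟨k, hk, ρ, hρ, w₁, fun w hw => ?_⟩
  filter_upwards [hA w hw, eventually_ge_atTop k] with n hn hnk j hj C hC hs
  have hpos : 0 < n.choose k := Nat.choose_pos hnk
  refine le_trans (sum_le_sum fun i _ => ?_) (hn j hj C hC hs)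
  exact fprm_pairProb_relMinterm_le_adv k i (C.monotone_eval_of_isOver_monotoneBasis hC) hpos

end Summit.PneNP.PneNP.Cruxes.ConstantBand.FlatPriorRelativeMinterms

end
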